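import Literature.NumberTheory.EllipticCurves.TakahashiRankOneOfEichlerSelberg
import Literature.NumberTheory.EllipticCurves.EichlerSelbergTraceWeightTwoSquarefree
import HarnessLib

/-!
# Discharge of `takahashi2001_brandtEigenLattice_rank_one`

[Proofs] Theorems only.  The named fact `takahashi2001_brandtEigenLattice_rank_one` of
`TakahashiDegreeFormulaFromDictionary` (Takahashi 2001, p. 78: for `W/ℚ` modular of squarefree
conductor `M r`, `r` prime, the `a(W)`-eigen-lattice of the Brandt matrices of an Eichler order of
type `(M, r)` is free of rank one — the Jacquet–Langlands / Eichler basis-theorem input of the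
degree formula) is proved: `TakahashiRankOneOfEichlerSelberg` reduces it to the Eichler–Selberg
trace identities `Tr(T_n | S₂(Γ₀(N))) = A₁ + A₂ + A₃ + A₄` for squarefree `N`, weight `2`, trivial
character and `(n, N) = 1` (Eichler's trace formula for Brandt matrices being in the tree), and these
are `EichlerSelbergTraceWeightTwoSquarefree.cuspidalHeckeTrace_eq_geometricSide`, proved through
Popa's modular-symbol approach with the Popa–Zagier Hecke element.  (This sibling file exists
because `TakahashiDegreeFormulaFromDictionaryProofs` is upstream of the reduction.)

## References
* [Takahashi2001] S. Takahashi, *Degrees of parametrizations of elliptic curves by Shimura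
  curves*, J. Number Theory 90 (2001), 74–88, §2 p. 78.
* [Pizer1980] A. Pizer, J. Algebra 64 (1980), Thm. 2.25, Thm. 2.28.
* [SchoofVandervlugt1991] R. Schoof, M. van der Vlugt, J. Combin. Theory A 57 (1991), Thm. 2.2.
* [Popa2014] A. Popa, Res. Math. Sci. 5 (2018), §2; [PopaZagier2017] arXiv:1711.00327, §4.
-/

noncomputable section

namespace Literature.NumberTheory.EllipticCurves

/-- **Takahashi 2001, p. 78 (rank one of the Brandt eigen-lattice), proved**: via the reduction to
the Eichler–Selberg trace identities at squarefree level (`takahashi2001_brandtEigenLattice_rank_one_of_cuspidalHeckeTrace_eq`)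
and their proof `ModularForms.cuspidalHeckeTrace_eq_geometricSide`.
[cite: Takahashi2001, §2 p. 78; Pizer1980, Thm. 2.28; SchoofVandervlugt1991, Thm. 2.2; Popa2014, §2] -/
theorem takahashi2001_brandtEigenLattice_rank_one_holds : takahashi2001_brandtEigenLattice_rank_one :=
  takahashi2001_brandtEigenLattice_rank_one_of_cuspidalHeckeTrace_eq
    fun _ _ hN _ hn hnN => ModularForms.cuspidalHeckeTrace_eq_geometricSide hN hn hnN

end Literature.NumberTheory.EllipticCurves

end
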